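import Summits.BirchSwinnertonDyer.Rank1Residual.GaloisImage.KolyvaginDeepDatum
import Summits.BirchSwinnertonDyer.Rank1Residual.GaloisImage.SakamotoN11InstanceDeepTower
import HarnessLib

/-!
# The DEEP FAMILY at every depth, packaged once: data `(η, D′, g′)_{k′}` on the deep Frobenius
# sub-classes with their SHAPE and their [S24] (1)(2) properties — the `∀ k′` deep binders of the END
# theorem `Assembly.padicValRat_le_of_certificate_of_transport` (p271924) from the two S24-DEEP ports,
# the `3`-adic tower, one Poitou–Tate family, Tate's `hEP` and an admissible `S`
# (cell `b2b-bsdres`, team n1011, seat p15 GEN 3, OWNERS row T-S24D = route planner 1's R1-47 with the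
# deep share of R1-45 (c) "tower packaging", `cells/n1011/ROUTE-1.md` §27.2 / §27.6; file 4 of the row)

HONEST FRAMING (cell `b2b-bsdres`, run/shared/lean/b2b/bsd-rank1-residual/, verbatim in every
file): the goal of the cell is to DELETE the COMBINATION-SHAPED residual classes of the
Birch–Swinnerton-Dyer formula for ALL analytic-rank `≤ 1` elliptic curves over `ℚ` — "full BSD
formula for every rank `≤ 1` curve in class `C`" assembled STRICTLY from published theorems — so
that the rank-`≤ 1` remainder becomes exactly the CONSTRUCTION-SHAPED classes, which are TYPED
(missing-input `Prop`s), NOT attempted. This is not "finishing BSD". Team n1011 (N10 / N11, the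
additive block X4 ∧ `p = 3`): research route on the CONSTRUCTION-SHAPED class X4; no claim beyond
the stated classes; nothing is booked; no label and no RESIDUAL-MAP mark is moved. Theorems only (no
definition, no named fact, no `sorry`); CONDITIONAL on the S24-DEEP PORT (cc-typer-1,
`KolyvaginDeepSubclass.lean`, p268594, flag `S24-DEEP-PORT@3`) taken as the hypotheses `hS24d` /
`hS24d₂`.

## What and why

Route planner 1's instance ledger (ROUTE-1 §27.2) lists the deep inputs of p271924 at every depth
`k′`: a datum `D′ k′` for `E[3^{k′+1}]` with `hDT′` (cyclotomic transverse), `hPP′`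
(`(D′ k′).primes ⊆ D.primes`), `hPS′` (primes off the admissible set), `hUT′` (Rubin's local shape),
a generator `g′ k′` of `KS₁` with `hg′`, `hgo′`, `hgen′`, and [S24] Thm. 4.4 (2) in ORDER form
`hR22′` — "the same constructor at every depth", with (B6): on a row with `#E(ℚ₃)[3] = 3^t` the data
are pinned at `3^{k+1+t}` (shallow) and `3^{k′+1+t}` (deep).  `exists_deepFamily_of_towerSurj` produces
ALL of them at once by `choose` over the depth from files 1–3 of the row: at depth `k′` the module is
`E[3^{k′+1}]` and the class is the deep class through `E[3^{c+1}]` at `3^{c+1}` with the UNIFORM class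
exponent `c = max k k′ + t` (so that `hPP′` holds at EVERY depth, also below `k`, by cc-typer-1's
monotonicity; for `k′ ≥ k` it is r1's `𝒫_{k′+1+t}`), and THE SHALLOW DATUM IS THE `k′ = k` MEMBER
(class exponent `k + t`: pinned when `t = 0`, deep when `t ≥ 1`).  `τ` stays DATA shared by all
depths (the dictionary port and bridge B1 pin the records' Kolyvagin primes to the class of the same
`τ`): its two properties at every level — `τ ∈ Gal(ℚ̄/ℚ(μ_{3^n}))` for all `n` and
`E[3^{m+1}]/(τ − 1) ≅ ℤ/3^{m+1}` for all `m` — hold for ONE `τ` under the tower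
(`exists_tau_forall_levels_of_towerSurj`, the `σ` of `exists_torsion_quotient_equiv_zmod_of_towerSurj`,
route planner 1's remark §28 (2)).  Binders of the family (nothing hidden): the two ports, `t`, `k`, the
tower, `τ` with its two all-level properties, ONE Poitou–Tate family `inv` at `3` with p271924's three
properties, Tate's `hEP` at every finite place, `S ⊇ ∞ ∪ {3} ∪ {bad}` (`hS`, `h3S`, `hbadS`), and
p271924's own `hfinT` (`E[3^{k′+1}]` finite at every depth — a theorem, `finite_geomTorsion_pow_mul`,
kept as a binder so that the statement elaborates exactly as p271924's does); the full-level families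
`inv′ k′` enter `hR22′` universally quantified, with three properties, as in p271924.

References: R. Sakamoto, JTNB **36** (2024) §2, Thm. 4.4 (pp. 920–926) [Sakamoto2024]; B. Mazur,
K. Rubin, Mem. AMS **799** (2004) §3.5 (H.5) (p. 27), Prop. A.2 (pp. 79–80) [MazurRubin2004];
C.-H. Kim, AJM **148** (2026) Thm. 3.13 [Kim2022StructureSelmer]; K. Rubin, PCMI **18** (2011)
Prop. 1.4.13, Prop. 1.9.5, Def. 1.9.6 [Rubin2011].
-/

noncomputable section

open scoped Classical NumberField ContRepresentation
open Field NumberField IsDedekindDomain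
open WeierstrassCurve Literature.NumberTheory.EllipticCurves Literature.NumberTheory.GaloisRepresentations
  Literature.NumberTheory.GaloisRepresentations.DiscreteGaloisModule Literature.NumberTheory.GaloisCohomology

namespace Summit.BirchSwinnertonDyer.Rank1Residual.GaloisImage.S24Deep

variable (W : WeierstrassCurve ℚ) [W.IsElliptic]

/-- **ONE `τ` for all levels under the `3`-adic tower** (route planner 1 §28 (2)): there is
`τ ∈ Γ_ℚ` fixing `μ_{3^n}` for EVERY `n` with `E[3^{m+1}]/(τ − 1)E[3^{m+1}] ≅ ℤ/3^{m+1}` for EVERY `m`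
(in the N11 spelling `geomTorsion W ((3:ℤ)^m·3)`) — the `σ` of
`exists_torsion_quotient_equiv_zmod_of_towerSurj` (p251128), transported level by level exactly as in
n1011-p13's `exists_rootsOfUnityFixer_cokerSubOne_equiv_of_towerSurj`.
[cite: Sakamoto2024, §2 (H.2) (p. 921)] [cite: MazurRubin2004, §3.5 (H.5) (p. 27)] -/
theorem exists_tau_forall_levels_of_towerSurj
    (htower : ∀ n : ℕ, W.HasSurjectiveModNGaloisRep (3 ^ n : ℕ)) :
    ∃ τ : absoluteGaloisGroup ℚ, (∀ n : ℕ, τ ∈ rootsOfUnityFixer ℚ (3 ^ n)) ∧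
      ∀ m : ℕ, Nonempty (cokerSubOne (W.torsionGaloisModule (((3 : ℕ) : ℤ) ^ m * ((3 : ℕ) : ℤ))) τ ≃+
        ZMod (3 ^ (m + 1))) := by
  haveI : Fact (Nat.Prime 3) := ⟨Nat.prime_three⟩
  obtain ⟨σ, hσ, hq⟩ := exists_torsion_quotient_equiv_zmod_of_towerSurj W 3 htower
  refine ⟨σ, fun n => mem_rootsOfUnityFixer_iff.mpr (fun t ht => hσ n t ht), fun m => ?_⟩
  have h := hq (m + 1)
  have hlevel : ((3 ^ (m + 1) : ℕ) : ℤ) = ((3 : ℕ) : ℤ) ^ m * ((3 : ℕ) : ℤ) := by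
    rw [Nat.cast_pow, pow_succ]
  rw [hlevel] at h
  have hf : ((W.torsionGaloisModule (((3 : ℕ) : ℤ) ^ m * ((3 : ℕ) : ℤ))) σ).toAddMonoidHom =
      (Multiplicative.toAdd (galoisRepTorsion W (((3 : ℕ) : ℤ) ^ m * ((3 : ℕ) : ℤ)) σ)).toAddMonoidHom :=
    AddMonoidHom.ext fun x => by
      rw [LinearMap.toAddMonoidHom_coe, torsionGaloisModule_apply_apply]; rfl
  change Nonempty (geomTorsion W _ ⧸ (((W.torsionGaloisModule _) σ).toAddMonoidHom -
    AddMonoidHom.id _).range ≃+ _)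
  rw [hf]
  exact h

/-- **THE DEEP FAMILY** — every `∀ k′` deep binder of p271924 at once, from the two S24-DEEP ports
under the tower.  For `t k : ℕ`, ONE `τ` with its two all-level properties, ONE Poitou–Tate family
`inv` at `3` (three properties), Tate's `hEP` and `S ⊇ ∞ ∪ {3} ∪ {bad}`, there are, at every depth
`k′`, primitive roots `η k′`, a Kolyvagin datum `D k′` for `E[3^{k′+1}]` and a Kolyvagin system
`g k′` such that: `(D k′).primes` is the deep class through `E[3^{c+1}]` at `3^{c+1}`, `c = max k k′ + t`;
cyclotomic transverse conditions (`hDT′`); THE canonical comparison maps at `3^{k′+1}`;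
`(D k′).primes ⊆ (D k).primes` (`hPP′`, the shallow datum being `D k`); primes off `S` (`hPS′`);
`#H¹_ur(ℚ_𝔮, E[3^{k′+1}]) = #𝒯_𝔮` at its primes (`hUT′`); `g k′ ∈ KS₁` of additive order `3^{k′+1}`
ℕ-generating `KS₁` (`hg′`, `hgo′`, `hgen′`); and [S24] Thm. 4.4 (2) in ORDER form at every level for
every full-level Poitou–Tate family with three properties (`hR22′`).  CONDITIONAL on both ports;
nothing booked. [cite: Sakamoto2024, Thm. 4.4 (1)(2) (p. 926)]
[cite: MazurRubin2004, §3.5 (H.5) (p. 27) and Prop. A.2 (pp. 79–80)] [cite: Kim2022StructureSelmer, Thm. 3.13] -/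
theorem exists_deepFamily_of_towerSurj
    (hS24d : kolyvaginSystems_freeRankOne_zmod_three_pow_deep)
    (hS24d₂ : kolyvaginSystems_idealOfBasis_eq_fittingIdeal_zmod_three_pow_deep) (t k : ℕ)
    (htower : ∀ n : ℕ, W.HasSurjectiveModNGaloisRep (3 ^ n : ℕ))
    (τ : absoluteGaloisGroup ℚ) (hτμ : ∀ n : ℕ, τ ∈ rootsOfUnityFixer ℚ (3 ^ n))
    (hτq : ∀ m : ℕ, Nonempty (cokerSubOne (W.torsionGaloisModule (((3 : ℕ) : ℤ) ^ m * ((3 : ℕ) : ℤ))) τ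
      ≃+ ZMod (3 ^ (m + 1))))
    (inv : LocalInvariants ℚ 3) (hperf : inv.IsPerfect) (hsum : inv.SumLocalTermEqZero)
    (hcompl : inv.SelmerComplement)
    (hEP : ∀ v : HeightOneSpectrum (𝓞 ℚ), localEulerPoincareCharacteristic (v.adicCompletion ℚ))
    (S : Finset (Place ℚ)) (hS : ∀ w : InfinitePlace ℚ, (Sum.inl w : Place ℚ) ∈ S)
    (h3S : ∀ v : HeightOneSpectrum (𝓞 ℚ), ((3 : ℕ) : 𝓞 ℚ) ∈ v.asIdeal → (Sum.inr v : Place ℚ) ∈ S)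
    (hbadS : ∀ v : HeightOneSpectrum (𝓞 ℚ), ¬ W.HasGoodReductionAt v → (Sum.inr v : Place ℚ) ∈ S)
    (hfinT : ∀ k' : ℕ, Finite (geomTorsion W (((3 : ℕ) : ℤ) ^ k' * ((3 : ℕ) : ℤ)))) :
    ∃ (η : ℕ → (q : HeightOneSpectrum (𝓞 ℚ)) → (ZMod (Ideal.absNorm q.asIdeal))ˣ)
      (D : ∀ k' : ℕ, KolyvaginDatum (W.torsionGaloisModule (((3 : ℕ) : ℤ) ^ k' * ((3 : ℕ) : ℤ))))
      (g : ∀ k' : ℕ, Finset (HeightOneSpectrum (𝓞 ℚ)) →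
        galoisCohomology (W.torsionGaloisModule (((3 : ℕ) : ℤ) ^ k' * ((3 : ℕ) : ℤ))) 1),
      -- SHAPE: deep class at the uniform exponent, cyclotomic transverse, canonical comparison
      (∀ k', (D k').primes = frobeniusClassPrimes
          (W.torsionGaloisModule (((3 : ℕ) : ℤ) ^ (max k k' + t) * ((3 : ℕ) : ℤ)))
          {v | (Sum.inr v : Place ℚ) ∈ S} τ (3 ^ (max k k' + t + 1))) ∧
      (∀ k', (D k').transverse = cyclotomicTransverse _) ∧
      (∀ k', (D k').HasCanonicalComparison (3 ^ (k' + 1)) (η k')) ∧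
      -- `hPP′`, `hPS′`, `hUT′`
      (∀ k', (D k').primes ⊆ (D k).primes) ∧
      (∀ k', ∀ q ∈ (D k').primes, (Sum.inr q : Place ℚ) ∉ S) ∧
      (∀ k', ∀ q ∈ (D k').primes,
        Nat.card (unramifiedSubgroup (GaloisRep.toLocal q
          (W.torsionGaloisModule (((3 : ℕ) : ℤ) ^ k' * ((3 : ℕ) : ℤ)))) 1) =
          Nat.card ((D k').transverse (Sum.inr q))) ∧
      -- [S24] (1): `hg′`, `hgo′`, `hgen′`
      (∀ k', g k' ∈ (D k').kolyvaginSystems (propagatedSelmerStructure W 3 k')) ∧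
      (∀ k', addOrderOf (g k') = 3 ^ (k' + 1)) ∧
      (∀ k', ∀ κ ∈ (D k').kolyvaginSystems (propagatedSelmerStructure W 3 k'), ∃ a : ℕ, κ = a • g k') ∧
      -- [S24] (2) in ORDER form: `hR22′`
      (∀ k' (inv' : LocalInvariants ℚ (3 ^ (k' + 1))), inv'.IsPerfect → inv'.SumLocalTermEqZero →
        inv'.SelmerComplement → ∀ d, (D k').IsLevel d →
          (Nat.card (inv'.dualSelmerStructure _
              ((D k').atLevel (propagatedSelmerStructure W 3 k') d)).selmerGroup ∣ 3 ^ (k' + 1) →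
            addOrderOf (g k' d) * Nat.card (inv'.dualSelmerStructure _
              ((D k').atLevel (propagatedSelmerStructure W 3 k') d)).selmerGroup = 3 ^ (k' + 1)) ∧
          (3 ^ (k' + 1) ∣ Nat.card (inv'.dualSelmerStructure _
              ((D k').atLevel (propagatedSelmerStructure W 3 k') d)).selmerGroup → g k' d = 0)) := by
  haveI : Fact (Nat.Prime 3) := ⟨Nat.prime_three⟩
  have hle : ∀ k' : ℕ, k' ≤ max k k' + t := fun k' => (le_max_right k k').trans (Nat.le_add_right _ _)
  -- the datum at every depth (file 1)
  have hdat := fun k' : ℕ => exists_eta_kolyvaginDatum_torsion_pow_mul_deep W (hle k')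
    {v | (Sum.inr v : Place ℚ) ∈ S} (hτμ _) (hτq k')
  choose η D hP hT hD using hdat
  -- the generator at every depth (file 3)
  have hgen := fun k' : ℕ =>
    haveI : Finite (geomTorsion W ((3 : ℕ) : ℤ)) := by
      simpa only [pow_zero, one_mul] using finite_geomTorsion_pow_mul W 3 0
    exists_generator_kolyvaginSystems_deep_of_towerSurj W hS24d hS24d₂ (hle k') htower τ (hτμ _)
      (hτq _) inv hperf hsum hcompl hEP S hS h3S hbadS (D k') (η k') (hP k') (hT k') (hD k')
  choose κ hκ hgo hgen' hR22 using hgen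
  refine ⟨η, D, fun k' => (κ k').1, hP, hT, hD, fun k' => ?_, fun k' => ?_, fun k' => ?_,
    fun k' => (κ k').2, hgo, hgen', fun k' inv' hperf' hsum' hcompl' d hd =>
      hR22 k' inv' hperf' hsum' hcompl' d hd⟩
  · -- `hPP′`: class exponent `max k k′ + t ≥ k + t = ` the exponent of `D k`
    exact primes_subset_torsion_pow_mul_deep W
      (Nat.add_le_add_right ((max_self k).le.trans (le_max_left k k')) t |>.trans_eq' (by rw [max_self]))
      (hP k) (hP k')
  · exact not_mem_of_primes_eq_deep _ _ _ (hP k')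
  · exact natCard_unramifiedSubgroup_eq_natCard_transverse_torsion_pow_mul_deep W (hle k') (hP k')
      (hT k') (hτμ _) (hτq k')

end Summit.BirchSwinnertonDyer.Rank1Residual.GaloisImage.S24Deep

end
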